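import Mathlib.RingTheory.PowerSeries.WeierstrassPreparation
import Mathlib.RingTheory.AdicCompletion.Basic
import HarnessLib

/-!
# Evaluation of a power series at a point of the maximal ideal through Weierstrass division:
# `f = (X − b)·q + f(b)`, the ring homomorphism `A⟦X⟧ → A`, `f ↦ f(b)` for `b ∈ 𝔪_A`, its kernel `(X − b)`,
# `X − b` a prime non-zero-divisor, and the height-two division `d₂·y₁ = w(X − b)·y₂, d₂(b) ≠ 0 ⟹ (X − b) ∣ y₁`

Topic `RingTheory/PowerSeries`. For a complete local ring `(A, 𝔪)` and `b ∈ 𝔪`, `X − b` is a distinguished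
polynomial of degree one, so Weierstrass division (Washington, *Introduction to Cyclotomic Fields*, Prop. 7.2;
Mathlib `PowerSeries.eq_mul_weierstrassDiv_add_weierstrassMod`) by `X − b` leaves a CONSTANT remainder: the value
`f(b) = Σ f_k b^k` (an `𝔪`-adically convergent sum). The tree's `Literature.NumberTheory.GaloisRepresentations.LubinTate.tEval`
(`PowerSeriesTopNilpotentIntertwine`, `…EvalDivision`, `…EvalShift`) does this for `b` in a PRINCIPAL ideal `(p)` with `A`
`(p)`-adically complete; THIS file treats any `b ∈ 𝔪` (needed over the two-variable base `A = 𝒪⟦X⟧`, `𝔪 = (π, X)`, where the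
points `b` produced by the Galois action have both a `π`- and an `X`-part) — everything PROVED (0 sorry), two definitions
(`maxEval`, `maxEvalHom`):

* §1 `map_mk_X_sub_C` (`(X − b) mod 𝔪 = X`), `order_map_mk_X_sub_C` (`= 1`), the `residue` variants;
* §2 `maxEval hb f := ((f %ʷ (X − C b)).coeff 0`, ★ `eq_X_sub_C_mul_weierstrassDiv_add_C_maxEval` (**`f = (X − b)·(f /ʷ (X − b)) + C(f(b))`**),
  ★ `maxEval_eq_of_eq` (uniqueness: `f = (X − b)·q + C r ⟹ f(b) = r`), `maxEval_C`, `maxEval_X`, `maxEval_add`, `maxEval_mul`,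
  ★ `maxEvalHom` (ring homomorphism), `maxEvalHom_surjective`;
* §3 ★ `X_sub_C_dvd_iff_maxEval_eq_zero`, ★ `ker_maxEvalHom_eq_span` (**`A⟦X⟧/(X − b) ≅ A`**), `X_sub_C_mem_nonZeroDivisors` (over any
  Hausdorff local `A`: `g(X − b) = 0 ⟹ g_n ∈ ⋂ 𝔪^k = 0`), `prime_X_sub_C` (`A` a domain);
* §4 ★★ `X_sub_C_dvd_of_mul_eq_mul`, **`exists_eq_mul_of_mul_eq_mul`** (`d₂·y₁ = (w·(X − b))·y₂`, `w` a unit, `d₂(b) ≠ 0`, `A` a domain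
  ⟹ `y₁ = (w·(X − b))·L`), `mem_nonZeroDivisors_of_eq_unit_mul_X_sub_C` — the division step of de Shalit II §4.12 (29)→(32) at a
  general point of `𝔪`.

## References
* [Washington1997] L. C. Washington, *Introduction to Cyclotomic Fields*, 2nd ed. (1997), §7.1 Prop. 7.2 (Weierstrass division).
* [BourbakiAC5to7] N. Bourbaki, *Algèbre commutative*, Ch. VII §3 no. 8, Prop. 5–6 (division by a distinguished series).
* [deShalit1987] E. de Shalit, *Iwasawa theory of elliptic curves with complex multiplication* (1987), Ch. II §4.12 (29)–(32).
-/

noncomputable section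

namespace Literature.RingTheory.PowerSeries

open _root_.PowerSeries

variable {A : Type*} [CommRing A] [IsLocalRing A] {b : A} (hb : b ∈ IsLocalRing.maximalIdeal A)

/-! ### §1. `X − b` reduces to `X` modulo `𝔪` -/

include hb in
/-- **`(X − b) mod 𝔪 = X`** (quotient-map form). [cite: Washington1997, §7.1] -/
theorem map_mk_X_sub_C :
    (X - C b : A⟦X⟧).map (Ideal.Quotient.mk (IsLocalRing.maximalIdeal A)) = X := by
  rw [map_sub, map_X, map_C, Ideal.Quotient.eq_zero_iff_mem.mpr hb, map_zero, sub_zero]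

include hb in
/-- `(X − b) mod 𝔪 = X` (residue-map form). [cite: Washington1997, §7.1] -/
theorem map_residue_X_sub_C : (X - C b : A⟦X⟧).map (IsLocalRing.residue A) = X :=
  map_mk_X_sub_C hb

include hb in
/-- `(X − b) mod 𝔪 ≠ 0`. [cite: Washington1997, §7.1] -/
theorem map_residue_X_sub_C_ne_zero : (X - C b : A⟦X⟧).map (IsLocalRing.residue A) ≠ 0 := by
  rw [map_residue_X_sub_C hb]; exact X_ne_zero

include hb in
/-- The reduced order of `X − b` is `1`: a distinguished polynomial of degree one. [cite: Washington1997, §7.1] -/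
theorem order_map_residue_X_sub_C : ((X - C b : A⟦X⟧).map (IsLocalRing.residue A)).order.toNat = 1 := by
  rw [map_residue_X_sub_C hb, order_X]; rfl

include hb in
/-- The same with `Ideal.Quotient.mk 𝔪`. [cite: Washington1997, §7.1] -/
theorem order_map_mk_X_sub_C : ((X - C b : A⟦X⟧).map (Ideal.Quotient.mk (IsLocalRing.maximalIdeal A))).order.toNat = 1 := by
  rw [map_mk_X_sub_C hb, order_X]; rfl

/-! ### §2. The value `f(b)` as the Weierstrass remainder; the evaluation homomorphism -/

section Complete

variable [IsAdicComplete (IsLocalRing.maximalIdeal A) A]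

/-- **`f(b)`** for `b ∈ 𝔪`: the constant Weierstrass remainder of `f` modulo `X − b` (for `b` in a principal ideal `(p)` of a
`(p)`-complete `A` this is the `(p)`-adic sum `Σ f_k b^k`, cf. the tree's `tEval`). [cite: Washington1997, §7.1 Prop. 7.2] -/
def maxEval (_hb : b ∈ IsLocalRing.maximalIdeal A) (f : A⟦X⟧) : A := (f %ʷ (X - C b)).coeff 0

include hb in
/-- The Weierstrass remainder modulo `X − b` is the constant `C(f(b))`. [cite: Washington1997, §7.1 Prop. 7.2] -/
theorem weierstrassMod_X_sub_C_eq_C (f : A⟦X⟧) : f %ʷ (X - C b) = Polynomial.C (maxEval hb f) := by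
  refine Polynomial.eq_C_of_degree_le_zero ?_
  have h := degree_weierstrassMod_lt f (X - C b : A⟦X⟧)
  rw [order_map_residue_X_sub_C hb, Nat.cast_one] at h
  exact Nat.WithBot.lt_one_iff_le_zero.mp h

include hb in
/-- ★ **`f = (X − b)·(f /ʷ (X − b)) + C(f(b))`.** [cite: Washington1997, §7.1 Prop. 7.2] -/
theorem eq_X_sub_C_mul_weierstrassDiv_add_C_maxEval (f : A⟦X⟧) :
    f = (X - C b) * (f /ʷ (X - C b)) + C (maxEval hb f) := by
  have hdiv := f.eq_mul_weierstrassDiv_add_weierstrassMod (map_residue_X_sub_C_ne_zero hb)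
  rw [weierstrassMod_X_sub_C_eq_C hb f, Polynomial.coe_C] at hdiv
  exact hdiv

include hb in
/-- ★ **Uniqueness of the value**: if `f = (X − b)·q + C r` then `r = f(b)` (and `q = f /ʷ (X − b)`).
[cite: Washington1997, §7.1 Prop. 7.2] -/
theorem maxEval_eq_of_eq {f q : A⟦X⟧} {r : A} (h : f = (X - C b) * q + C r) : maxEval hb f = r := by
  have H : f.IsWeierstrassDivision (X - C b) q (Polynomial.C r) := by
    refine ⟨?_, ?_⟩
    · rw [order_map_mk_X_sub_C hb, Nat.cast_one]
      exact lt_of_le_of_lt Polynomial.degree_C_le zero_lt_one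
    · rw [Polynomial.coe_C]; exact h
  have h2 := (H.unique (map_residue_X_sub_C_ne_zero hb)).2
  rw [weierstrassMod_X_sub_C_eq_C hb f] at h2
  have h3 := congrArg (Polynomial.coeff · 0) h2
  simp only [Polynomial.coeff_C_zero] at h3
  exact h3.symm

include hb in
/-- The quotient is unique too: `f = (X − b)·q + C r ⟹ q = f /ʷ (X − b)`. [cite: Washington1997, §7.1 Prop. 7.2] -/
theorem weierstrassDiv_eq_of_eq {f q : A⟦X⟧} {r : A} (h : f = (X - C b) * q + C r) : f /ʷ (X - C b) = q := by
  have H : f.IsWeierstrassDivision (X - C b) q (Polynomial.C r) := by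
    refine ⟨?_, ?_⟩
    · rw [order_map_mk_X_sub_C hb, Nat.cast_one]
      exact lt_of_le_of_lt Polynomial.degree_C_le zero_lt_one
    · rw [Polynomial.coe_C]; exact h
  exact (H.unique (map_residue_X_sub_C_ne_zero hb)).1.symm

include hb in
/-- `(C a)(b) = a`. [cite: Washington1997, §7.1] -/
theorem maxEval_C (a : A) : maxEval hb (C a) = a :=
  maxEval_eq_of_eq hb (q := 0) (by rw [mul_zero, zero_add])

include hb in
/-- `X(b) = b`. [cite: Washington1997, §7.1] -/
theorem maxEval_X : maxEval hb X = b :=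
  maxEval_eq_of_eq hb (q := 1) (by rw [mul_one, sub_add_cancel])

include hb in
/-- `1(b) = 1`. [cite: Washington1997, §7.1] -/
theorem maxEval_one : maxEval hb 1 = 1 := by
  rw [← map_one C, maxEval_C]

include hb in
/-- Additivity of evaluation. [cite: Washington1997, §7.1] -/
theorem maxEval_add (f g : A⟦X⟧) : maxEval hb (f + g) = maxEval hb f + maxEval hb g := by
  refine maxEval_eq_of_eq hb (q := f /ʷ (X - C b) + g /ʷ (X - C b)) ?_
  conv_lhs => rw [eq_X_sub_C_mul_weierstrassDiv_add_C_maxEval hb f, eq_X_sub_C_mul_weierstrassDiv_add_C_maxEval hb g]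
  rw [map_add]; ring

include hb in
/-- Multiplicativity of evaluation (`C r · C r'` is again a constant remainder). [cite: Washington1997, §7.1] -/
theorem maxEval_mul (f g : A⟦X⟧) : maxEval hb (f * g) = maxEval hb f * maxEval hb g := by
  have hf := eq_X_sub_C_mul_weierstrassDiv_add_C_maxEval hb f
  have hg := eq_X_sub_C_mul_weierstrassDiv_add_C_maxEval hb g
  refine maxEval_eq_of_eq hb (q := (f /ʷ (X - C b)) * g + C (maxEval hb f) * (g /ʷ (X - C b))) ?_
  calc f * g = ((X - C b) * (f /ʷ (X - C b)) + C (maxEval hb f)) * g := by rw [← hf]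
    _ = (X - C b) * ((f /ʷ (X - C b)) * g) + C (maxEval hb f) * g := by ring
    _ = (X - C b) * ((f /ʷ (X - C b)) * g) + C (maxEval hb f) * ((X - C b) * (g /ʷ (X - C b)) + C (maxEval hb g)) := by
        rw [← hg]
    _ = (X - C b) * ((f /ʷ (X - C b)) * g + C (maxEval hb f) * (g /ʷ (X - C b))) + C (maxEval hb f * maxEval hb g) := by
        rw [map_mul]; ring

include hb in
/-- `(X − b)·q` evaluates to `0`. [cite: Washington1997, §7.1] -/
theorem maxEval_X_sub_C_mul (q : A⟦X⟧) : maxEval hb ((X - C b) * q) = 0 :=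
  maxEval_eq_of_eq hb (q := q) (by rw [map_zero, add_zero])

/-- ★ **Evaluation at `b ∈ 𝔪` is a ring homomorphism `A⟦X⟧ →+* A`.** [cite: Washington1997, §7.1 Prop. 7.2] -/
def maxEvalHom (hb : b ∈ IsLocalRing.maximalIdeal A) : A⟦X⟧ →+* A where
  toFun := maxEval hb
  map_one' := maxEval_one hb
  map_mul' := maxEval_mul hb
  map_zero' := by rw [← map_zero C, maxEval_C]
  map_add' := maxEval_add hb

include hb in
/-- Unfolding `maxEvalHom`. [cite: Washington1997, §7.1] -/
@[simp] theorem maxEvalHom_apply (f : A⟦X⟧) : maxEvalHom hb f = maxEval hb f := rfl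

include hb in
/-- `maxEvalHom` is surjective (`C a ↦ a`). [cite: Washington1997, §7.1] -/
theorem maxEvalHom_surjective : Function.Surjective (maxEvalHom hb) := fun a => ⟨C a, maxEval_C hb a⟩

include hb in
/-- On polynomials the value is the usual one: `maxEval b ↑P = P.eval b`. [cite: Washington1997, §7.1] -/
theorem maxEval_coe (P : Polynomial A) : maxEval hb (P : A⟦X⟧) = P.eval b := by
  induction P using Polynomial.induction_on' with
  | add p q hp hq => rw [Polynomial.coe_add, maxEval_add, hp, hq, Polynomial.eval_add]
  | monomial n a =>
    rw [← Polynomial.C_mul_X_pow_eq_monomial, Polynomial.coe_mul, Polynomial.coe_pow, Polynomial.coe_C, Polynomial.coe_X,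
      ← maxEvalHom_apply, map_mul, map_pow, maxEvalHom_apply, maxEvalHom_apply, maxEval_C, maxEval_X, Polynomial.eval_mul,
      Polynomial.eval_pow, Polynomial.eval_C, Polynomial.eval_X]

/-! ### §3. Kernel `(X − b)`; `X − b` is a prime non-zero-divisor -/

include hb in
/-- ★ **`(X − b) ∣ f ↔ f(b) = 0`.** [cite: Washington1997, §7.1 Prop. 7.2] -/
theorem X_sub_C_dvd_iff_maxEval_eq_zero (f : A⟦X⟧) : (X - C b) ∣ f ↔ maxEval hb f = 0 := by
  constructor
  · rintro ⟨q, rfl⟩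
    exact maxEval_X_sub_C_mul hb q
  · intro h0
    refine ⟨f /ʷ (X - C b), ?_⟩
    conv_lhs => rw [eq_X_sub_C_mul_weierstrassDiv_add_C_maxEval hb f]
    rw [h0, map_zero, add_zero]

include hb in
/-- ★ **`ker (f ↦ f(b)) = (X − b)`**: `A⟦X⟧/(X − b) ≅ A`. [cite: Washington1997, §7.1 Prop. 7.2] -/
theorem ker_maxEvalHom_eq_span : RingHom.ker (maxEvalHom hb) = Ideal.span {X - C b} := by
  ext f
  rw [RingHom.mem_ker, maxEvalHom_apply, Ideal.mem_span_singleton, X_sub_C_dvd_iff_maxEval_eq_zero hb]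

include hb in
/-- `f ∈ (X − b) ↔ f(b) = 0`. [cite: Washington1997, §7.1 Prop. 7.2] -/
theorem mem_span_X_sub_C_iff_maxEval_eq_zero (f : A⟦X⟧) : f ∈ Ideal.span {X - C b} ↔ maxEval hb f = 0 := by
  rw [Ideal.mem_span_singleton, X_sub_C_dvd_iff_maxEval_eq_zero hb]

include hb in
/-- **`X − b` is prime** (`A` a domain): `A⟦X⟧/(X − b) ≅ A` is a domain. [cite: BourbakiAC5to7, Ch. VII §3 no. 8] -/
theorem prime_X_sub_C [IsDomain A] : Prime (X - C b : A⟦X⟧) := by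
  rw [← Ideal.span_singleton_prime, ← ker_maxEvalHom_eq_span hb]
  · exact RingHom.ker_isPrime _
  · intro h0
    have h1 := congrArg (coeff 1) h0
    rw [map_sub, coeff_one_X, coeff_C, if_neg one_ne_zero, sub_zero, map_zero] at h1
    exact one_ne_zero h1

end Complete

include hb in
/-- **`X − b` is a non-zero-divisor** for `b ∈ 𝔪` over any local ring Hausdorff for `𝔪`: from `g·(X − b) = 0`, `g_n = b·g_{n+1} = b^k g_{n+k}
∈ 𝔪^k` for every `k`, so `g_n ∈ ⋂ 𝔪^k = 0`. [cite: BourbakiAC5to7, Ch. VII §3 no. 8, Prop. 5] -/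
theorem X_sub_C_mem_nonZeroDivisors [IsHausdorff (IsLocalRing.maximalIdeal A) A] :
    (X - C b : A⟦X⟧) ∈ nonZeroDivisors A⟦X⟧ := by
  refine mem_nonZeroDivisors_iff_left.mpr fun g hg => ?_
  -- `g_n = b · g_{n+1}` for all `n`
  have hrec : ∀ n, coeff n g = b * coeff (n + 1) g := by
    intro n
    have h := congrArg (coeff (n + 1)) hg
    rw [sub_mul, map_sub, coeff_succ_X_mul, coeff_C_mul, map_zero, sub_eq_zero] at h
    exact h
  have hpow : ∀ k n, coeff n g = b ^ k * coeff (n + k) g := by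
    intro k
    induction k with
    | zero => intro n; rw [pow_zero, one_mul, add_zero]
    | succ k ih => intro n; rw [ih n, hrec (n + k), ← mul_assoc, ← pow_succ, add_assoc]
  ext n
  rw [map_zero]
  refine IsHausdorff.haus' (I := IsLocalRing.maximalIdeal A) (M := A) _ fun k => ?_
  rw [SModEq.zero, smul_eq_mul, Ideal.mul_top, hpow k n]
  exact Ideal.mul_mem_right _ _ (Ideal.pow_mem_pow hb k)

include hb in
/-- A unit multiple `w·(X − b)` is a non-zero-divisor. [cite: BourbakiAC5to7, Ch. VII §3 no. 8, Prop. 5] -/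
theorem mem_nonZeroDivisors_of_eq_unit_mul_X_sub_C [IsHausdorff (IsLocalRing.maximalIdeal A) A] {d₁ w : A⟦X⟧} (hw : IsUnit w)
    (hd₁ : d₁ = w * (X - C b)) : d₁ ∈ nonZeroDivisors A⟦X⟧ := by
  rw [hd₁]
  exact mul_mem (IsUnit.mem_nonZeroDivisors hw) (X_sub_C_mem_nonZeroDivisors hb)

/-! ### §4. The height-two division step at a point of `𝔪` -/

section Division

variable [IsAdicComplete (IsLocalRing.maximalIdeal A) A]

include hb in
/-- ★★ **If `d₂·y₁ = (w·(X − b))·y₂` and `d₂(b) ≠ 0` (`A` a domain), then `(X − b) ∣ y₁`** (evaluate at `b`).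
[cite: deShalit1987, Ch. II §4.12 (29)–(32)] -/
theorem X_sub_C_dvd_of_mul_eq_mul [IsDomain A] {d₂ y₁ y₂ w : A⟦X⟧}
    (h : d₂ * y₁ = w * (X - C b) * y₂) (hd₂ : maxEval hb d₂ ≠ 0) : (X - C b) ∣ y₁ := by
  rw [X_sub_C_dvd_iff_maxEval_eq_zero hb]
  have hev := congrArg (maxEval hb) h
  rw [maxEval_mul, mul_assoc, maxEval_mul, maxEval_X_sub_C_mul, mul_zero] at hev
  exact (mul_eq_zero.mp hev).resolve_left hd₂

include hb in
/-- ★★ **DIVISION STEP**: `d₂·y₁ = d₁·y₂`, `d₁ = w·(X − b)` with `w` a unit, `d₂(b) ≠ 0`, `A` a domain ⟹ **`y₁ = d₁·L`** for some `L`.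
[cite: deShalit1987, Ch. II §4.12 (29)–(32)] -/
theorem exists_eq_mul_of_mul_eq_mul [IsDomain A] {d₁ d₂ y₁ y₂ w : A⟦X⟧} (hw : IsUnit w)
    (hd₁ : d₁ = w * (X - C b)) (h : d₂ * y₁ = d₁ * y₂) (hd₂ : maxEval hb d₂ ≠ 0) :
    ∃ L : A⟦X⟧, y₁ = d₁ * L := by
  rw [hd₁] at h
  obtain ⟨q, hq⟩ := X_sub_C_dvd_of_mul_eq_mul hb h hd₂
  refine ⟨↑hw.unit⁻¹ * q, ?_⟩
  rw [hd₁, hq, mul_assoc, mul_left_comm (X - C b), ← mul_assoc, IsUnit.mul_val_inv, one_mul]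

include hb in
/-- The quotient in the division step is unique (`d₁` is a non-zero-divisor). [cite: deShalit1987, Ch. II §4.12 (32)] -/
theorem eq_of_mul_eq_mul_of_eq_unit_mul_X_sub_C {d₁ w L L' : A⟦X⟧} (hw : IsUnit w) (hd₁ : d₁ = w * (X - C b))
    (h : d₁ * L = d₁ * L') : L = L' :=
  (mul_cancel_left_mem_nonZeroDivisors (mem_nonZeroDivisors_of_eq_unit_mul_X_sub_C hb hw hd₁)).mp h

end Division

end Literature.RingTheory.PowerSeries

end
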